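import Summits.QuantumFields.QCD.Theses.GapBuysCauchyRate
import Literature.MathematicalPhysics.QuantumFieldTheory.GaugeCovariantBlockMap

/-!
# Stub `stub_chiralOfLightPseudoscalar` of line `birth` for crux `GapBuysCauchyRate.LadderCauchyRate`
(item stmt-QuantumFields-17307, route route-QuantumFields-GapBuysCauchyRate, sub-problem QCD)

What is proved: the CHIRAL TRANSFER LEMMA. If a regularisation `reg` carries a "light
pseudoscalar" — a rate function `μ` on positive mass tuples with `μ m < ε` available for every
`ε > 0`, and at every positive `m` a pair of local observables `A, B` whose connected correlator on
every torus of side `2S+1 ≥ 2L_k+1` is bounded BELOW by `c·exp(−μ(m)·a_k·n)` (`c > 0`) at all times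
`n ≤ S` with `a_k n ≥ T₀`, eventually in `k` — then `reg.IsChiralAtZero`.

Proof outline (pure real analysis on the two definitions `QCDRegularisation.IsChiralAtZero`,
`QCDScheme.HasLatticeMassGap`; the fields of `reg.scheme m 0 0` are those of `reg` by `rfl`):
given `ε > 0` pick `m > 0` with `μ m < ε`; if `(reg.scheme m 0 0)` had the uniform gap `ε`, the gap
clause for the pair `(A, B)` gives `C` and an eventual-in-`k` UPPER bound `C·exp(−ε·a_k·n)`. Fix one
`k` in both eventual sets and evaluate both bounds at `n = S` for large `S` (so that `L_k ≤ S` and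
`T₀ ≤ a_k S`, the latter because `a_k > 0`): `c·exp(−μ a_k S) ≤ C·exp(−ε a_k S)`, i.e.
`c ≤ C·exp(−(ε−μ) a_k S) → 0` as `S → ∞` since `(ε − μ m) a_k > 0` — contradiction with `c > 0`.
Sources: Mathlib filter/`Real.exp` asymptotics only.

Pure theorem file (no definitions): the registered stub signature, proved in tree vocabulary.
-/

noncomputable section

namespace Summit.QuantumFields.QCD.Cruxes.LadderCauchyRate.Birth

open scoped BigOperators Topology Classical
open MeasureTheory Filter
open Literature.MathematicalPhysics.AQFT Literature.Probability.LatticeModels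
  Literature.MathematicalPhysics.QuantumLattice Literature.MathematicalPhysics.QuantumFieldTheory
open Summit.QuantumFields.QCD.Theses.GapBuysCauchyRate

/-- Splitting an exponential decay rate: `e^{-(ε-μ)y} · e^{-μ y} = e^{-ε y}`. -/
private theorem exp_neg_sub_mul_mul_exp_neg_mul (ε μ y : ℝ) :
    Real.exp (-((ε - μ) * y)) * Real.exp (-(μ * y)) = Real.exp (-(ε * y)) := by
  rw [← Real.exp_add]
  congr 1
  ring

/-- The elementary contradiction behind the chiral transfer: a positive constant `c` cannot sit
below `C·e^{-ε y}/e^{-μ y} = C·e^{-(ε-μ) y}` along `y = a·S → ∞` when `μ < ε` and `a > 0`. Phrased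
on the two one-sided bounds at `n = S`: if for all large `S : ℕ` we have
`c·e^{-μ a S} ≤ C·e^{-ε a S}`, then `c ≤ 0`. -/
private theorem not_pos_of_eventually_sandwich {c C ε μ a T₀ : ℝ} {L : ℕ} (ha : 0 < a)
    (hμε : μ < ε)
    (h : ∀ S : ℕ, L ≤ S → T₀ ≤ a * S →
      c * Real.exp (-(μ * (a * S))) ≤ C * Real.exp (-(ε * (a * S)))) :
    c ≤ 0 := by
  refine le_of_not_gt fun hc => ?_
  have h0 : Tendsto (fun S : ℕ => a * (S : ℝ)) atTop atTop :=
    tendsto_natCast_atTop_atTop.const_mul_atTop ha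
  have h1 : Tendsto (fun S : ℕ => (ε - μ) * (a * (S : ℝ))) atTop atTop :=
    h0.const_mul_atTop (sub_pos.2 hμε)
  have h2 : Tendsto (fun S : ℕ => C * Real.exp (-((ε - μ) * (a * (S : ℝ))))) atTop (𝓝 (C * 0)) :=
    (Real.tendsto_exp_neg_atTop_nhds_zero.comp h1).const_mul C
  rw [mul_zero] at h2
  have hlt : ∀ᶠ S : ℕ in atTop, C * Real.exp (-((ε - μ) * (a * (S : ℝ)))) < c :=
    h2.eventually (gt_mem_nhds hc)
  have hL : ∀ᶠ S : ℕ in atTop, L ≤ S := eventually_ge_atTop L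
  have hT : ∀ᶠ S : ℕ in atTop, T₀ ≤ a * (S : ℝ) := h0.eventually_ge_atTop T₀
  obtain ⟨S, ⟨hS, hTS⟩, hltS⟩ := ((hL.and hT).and hlt).exists
  have hle := h S hS hTS
  have hpos : 0 < Real.exp (-(μ * (a * (S : ℝ)))) := Real.exp_pos _
  have hlt' := mul_lt_mul_of_pos_right hltS hpos
  rw [mul_assoc, exp_neg_sub_mul_mul_exp_neg_mul] at hlt'
  exact absurd (hle.trans_lt hlt') (lt_irrefl _)

/-- (S4) a light pseudoscalar gives `IsChiralAtZero` — size M, provable now.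
Registered signature = `ChiralTransferStmt` with `HasLightPseudoscalar` unfolded. -/
theorem stub_chiralOfLightPseudoscalar :
    ∀ (Nf : ℕ) (reg : QCDRegularisation Nf),
      (∃ μ : (Fin Nf → ℝ) → ℝ,
        (∀ ε > (0 : ℝ), ∃ m : Fin Nf → ℝ, (∀ f, 0 < m f) ∧ μ m < ε) ∧
        ∀ m : Fin Nf → ℝ, (∀ f, 0 < m f) →
          ∃ (R R' : ℕ) (A : QCDLatticeObservable Nf R) (B : QCDLatticeObservable Nf R') (c T₀ : ℝ),
            0 < c ∧
            ∀ᶠ k in Filter.atTop, ∀ S : ℕ, reg.L k ≤ S → ∀ n : ℕ, n ≤ S → T₀ ≤ reg.a k * n →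
              c * Real.exp (-(μ m * (reg.a k * n))) ≤
                ‖qcdLatticeConnectedCorr (reg.β k) (2 * S + 1) (fun fl => (reg.scheme m 0 0).mq fl k)
                  A B n‖) →
      reg.IsChiralAtZero := by
  intro Nf reg hlight ε hε
  obtain ⟨μ, hsmall, hlow⟩ := hlight
  obtain ⟨m, hm, hμε⟩ := hsmall ε hε
  refine ⟨m, hm, fun hgap => ?_⟩
  obtain ⟨R, R', A, B, c, T₀, hc, hev⟩ := hlow m hm
  obtain ⟨C, hC⟩ := hgap R R' A B
  obtain ⟨k, hk₁, hk₂⟩ := (hev.and hC).exists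
  have key : ∀ S : ℕ, reg.L k ≤ S → T₀ ≤ reg.a k * S →
      c * Real.exp (-(μ m * (reg.a k * S))) ≤ C * Real.exp (-(ε * (reg.a k * S))) := by
    intro S hS hTS
    have hup : ‖qcdLatticeConnectedCorr (reg.β k) (2 * S + 1) (fun fl => (reg.scheme m 0 0).mq fl k)
        A B S‖ ≤ C * Real.exp (-(ε * (reg.a k * S))) :=
      hk₂ S hS S le_rfl
    exact (hk₁ S hS S le_rfl hTS).trans hup
  exact absurd (not_pos_of_eventually_sandwich (reg.a_pos k) hμε key) (not_le.2 hc)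

end Summit.QuantumFields.QCD.Cruxes.LadderCauchyRate.Birth

end
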